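import Summits.AtomisticToContinuum.BoseEinsteinCondensation.Theses.BECStronglyRayleigh
import Literature.Combinatorics.StablePolynomials.Limits
import Literature.Combinatorics.StablePolynomials.ElementarySymmetric
import Literature.MathematicalPhysics.QuantumLattice.LiebMattisSectorPF
import Literature.MathematicalPhysics.QuantumLattice.PerronFrobeniusGroundState
import Literature.MathematicalPhysics.QuantumLattice.TokenSliding

/-!
# Line `heisenberg-point-deformation` — crux `BECStronglyRayleigh.GroundStateStability`
# (stmt-AtomisticToContinuum-9672)

Skeleton (crux-plan, round 1, generation 1) of the crux-idea card `heisenberg-point-deformation`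
(crux-ideate k1 gen 2; triage r1-2: pass "with doubt", r1-3: pass "N = 2 theorem; type the sharpened
loss lemma and the non-structural critical-zero statement before planning") — both sharpenings are
typed below (`SharpenedLossLemma`, `NoBadCriticalZero`).

THE CRUX. Every magnetisation-sector ground vector `ψ` of
`H(Δ, μ) = xxzHamiltonian 1 G (-1) Δ + Σ_x μ_x Sᶻ_x` on a finite connected graph `G`, `|Δ| ≤ 1`,
`μ` real, has an `H^Λ`-stable amplitude polynomial `p_ψ(z) = Σ_S ψ(1_S) z^S`.

THE LINE — a continuity method on the ground-state family itself; no operator is asked to preserve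
anything (orthogonal to the preserver lines `stable-cone-variational-selection` / `six-vertex-euler-gates`).

* PARAMETER PATH. Two straight segments `(1, 0) → (0, 0) → (Δ, μ)` in the `(Δ, μ)`-plane; both have
  their open interior inside the open window `|Δ'| < 1`, whatever `|Δ| ≤ 1` is (this dog-leg is what
  makes the closed window `|Δ| = 1` come for free: the elliptic estimate is only ever used at interior
  points or at the anchor).
* ANCHOR (`stub_anchor`). At the ferromagnetic `SU(2)` point `(Δ, μ) = (1, 0)` a positive sector ground
  vector is swap-invariant along every edge (`¼ - 𝐒_a·𝐒_b` is the bond-singlet projector and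
  annihilates the ground vector), hence constant on `N`-sets by token sliding: `p = c·e_N`, which is
  line-hyperbolic (indeed stable, `isRealStable_esymm`) and whose pinned minors `c·e_{N-|A|}` have no
  critical zero of support `≥ N - |A|` (descending Newton-identity induction).
* WHAT IS PROPAGATED. Not stability but LINE-HYPERBOLICITY w.r.t. `𝟙`: every complex zero of
  `u ↦ p(x + u𝟙)`, `x` real, is real (`LineHyperbolic`). For a homogeneous multi-affine polynomial with
  nonnegative coefficients this is equivalent to `H^Λ`-stability by Gårding's cone theorem (the open
  orthant lies in the hyperbolicity cone of `𝟙`) — `stub_gardingOrthant` converts at the very end.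
* FIRST LOSS (`stub_firstLoss`, soft analysis; uses sector Perron–Frobenius `stub_sectorPerron`). Along a
  segment the positive unit ground vector `φ_t` is a continuous branch; `{t : p_{φ_t} line-hyperbolic}` is
  closed (univariate Hurwitz, `eq_zero_or_isUpperHalfPlaneStable_of_tendsto_coeff` with one variable) and
  contains `0`; if it misses `1`, there is a first-loss time `t* < 1` with `p_{φ_{t*}}` hyperbolic and
  non-hyperbolic `p_{φ_{tₙ}} → p_{φ_{t*}}`.
* LOSS ⇒ CRITICAL ZERO (`stub_sharpenedLoss`, pure geometry of polynomials — the SHARPENED loss lemma the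
  triage asked for). If positive degree-`N` multi-affine families `bₙ → a` lose line-hyperbolicity in the
  limit (`a` hyperbolic, `a > 0` on all `N`-sets, every `bₙ` not), then some PINNED MINOR
  `q_A(w) = Σ_{T ∩ A = ∅} a(A ∪ T) w^T`, `|A| ≤ N - 2` (`A = ∅` allowed), has a NON-STRUCTURAL real
  critical zero `y` on `σ ∖ A`: `q_A(y) = 0`, `∇q_A(y) = 0`, `|supp y| ≥ N - |A|` (`HasBadCriticalZero`).
  Proof sketch (planner, line card §Stubs): normalise the bad zeros `ζₙ = xₙ + uₙ𝟙`; the conjugate pair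
  `uₙ, ūₙ` merges on the real axis (Claim 1: `Im uₙ → 0` by hyperbolicity of the limit; Claim 2: the
  limit has a double root, by continuity of division by the monic quadratic `(s-uₙ)(s-ūₙ)`); the
  Atiyah–Bott–Gårding order-two lemma (a double root in a cone direction is a critical zero; elementary
  via the rescaling `s = |t|^{1/m} w` + one-variable Hurwitz) gives a real critical zero `y` of `p_a`;
  if `y` is structural (`|supp y| ≤ N - 2`; `|supp y| = N - 1` is impossible for positive coefficients)
  BLOW UP at the stratum `supp y = A`: `p(y + εv) = ε^{N-|A|}(y^A q_A(v) + O(ε))` EXACTLY (multi-affinity),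
  the rescaled bad zeros converge to a critical zero of `q_A`, and one recurses on `|A| ≤ N - 2`
  (a zero-progress step is followed by a unit-norm step, so `|A|` grows every second step; at
  `|A| = N - 2` the minor is a positive quadratic form whose nonzero kernel vectors have support `≥ 2`).
* NO BAD CRITICAL ZERO IN THE OPEN WINDOW (`stub_noCriticalZero`, the card's transfer `C⁺`, HARDEST).
  For `|Δ| < 1` no pinned minor of a positive sector ground vector has a non-structural real critical
  zero. Its tool is the COHERENT REPRESENTATION (`stub_coherentRep`, an exact operator identity checked
  numerically in the tree conventions, `compute/check_coherent_rep.py`, 20 cells, rel. err `8e-16`):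
  pairing `H` with the product vector `Φ(y) = ⊗_x(|↓⟩ + y_x|↑⟩)` writes `p_{Hψ}` as the degenerate-elliptic
  operator `Σ_{ab∈E} [q_Δ(y_a,y_b)∂_a∂_b - ½(y_b-Δy_a)∂_a - ½(y_a-Δy_b)∂_b - Δ/4] p_ψ + Σ_a μ_a(y_a∂_a - ½)p_ψ`,
  `q_Δ(u,v) = ½(u²+v²) - Δuv ≻ 0` exactly for `|Δ| < 1`. At a critical zero of `p_ψ` (ψ an eigenvector)
  everything but `Σ q_Δ ∂_a∂_b p` drops out; for `N = 2` this is `Σ_{ab∈E} q_Δ(y_a,y_b)ψ_{ab} = 0` with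
  `ψ_{ab} > 0`, forcing `y = 0` edge by edge on a connected graph — the card's ten-line proof of the crux
  for two particles. For `N ≥ 3` the pinned minors obey the coupled identities (★_A) obtained by
  differentiating the representation in `y_A`; their sign structure is the open heart of the line
  (numerics: card T5b / kit j007464 found no non-structural critical zero of `p` inside the window on
  P5/C5/2×3, N = 3, 4, and near-zeros `1e-7` at `Δ ∈ {-1.3, -1.6}`; planner scan
  `compute/check_pinned_kernels.py` of the DEEPEST pinning level `|A| = N - 2`, where a bad critical zero
  is exactly a kernel vector of the conditional pair kernel `K_A(i,j) = φ(A ∪ {i,j})`: on P5, C5, S4, house,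
  K5, P6, C6, 2×3, S5 with N = 3, 4, `μ = 0` and 3 random fields each, every `K_A` is Lorentzian and
  nonsingular at all 13 grid points of `(-1, 1)` (min `σ_min/σ_max = 4.7e-5`, monotone field-localisation
  tails, no interior dip), singular to `1e-17` exactly at `Δ = -1`, `μ = 0` on the bipartite P6 / 2×3, and
  non-Lorentzian kernels appear from `Δ ≤ -1.1` (and `Δ ≥ 1.3` on paths)).

Composition (sorry-free, kernel-checked): `GroundStateStability_of` takes the seven registered stubs
(keyed BY NAME through the `Registered.stub_*` aliases, the device of
`Lines/six-vertex-euler-gates.lean`) and concludes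
`Summit.AtomisticToContinuum.BoseEinsteinCondensation.Theses.BECStronglyRayleigh.GroundStateStability` BY NAME:
sector PF gives `N` with `M = N - |Λ|/2`, a positive ground vector `φ` and `ψ = c φ`; the segment lemma
`lineHyperbolic_propagate` (first loss + sharpened loss + no bad critical zero) is applied to
`(1,0) → (0,0)` (anchor facts at `t = 0`) and then to `(0,0) → (Δ,μ)`; Gårding turns line-hyperbolicity
of `p_φ` into `H^Λ`-stability; `c ≠ 0` finishes. The final `example` wires the actual stubs in.

DISPROOF OBLIGATIONS (`Cruxes/GroundStateStability/Disproof.lean`, cdisprove cycle 1, re-read at plan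
time): `_false_without_connected` — connectivity is consumed by `stub_sectorPerron` (token graph),
`stub_anchor` (token sliding makes the anchor vector constant) and `stub_noCriticalZero` (`y = 0`
propagates along edges); `_false_with_antiferro_sign` — `J = -1` enters at `stub_anchor` (with `J = +1`
the sector ground vector at `Δ = 1` is NOT `e_N`) and at `stub_sectorPerron` (hopping `-½ ≤ 0`);
`_false_without_groundState` — "ground" (not "eigen") enters through Perron positivity `ψ_S > 0`,
used by `stub_sharpenedLoss` (positivity of the limit family) and `stub_noCriticalZero`;
`_false_without_sector` — every stub is sector-wise. Tightness `groundStateStability_false_with_window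
(7/3)` and the `Δ = -1` boundary are matched by the mechanism: `q_Δ` loses definiteness exactly at
`|Δ| = 1`, and the Néel sign vector is a full-support critical zero at `Δ = -1` (Lieb–Mattis lowest
weight), so `NoBadCriticalZero` is stated for the OPEN window only and the closed window is reached by
the dog-leg path, never by an estimate at `|Δ| = 1`. No landed Negative lemma exists for this crux
(nothing under `Theorems/GroundStateStability/Negative/`); `ledger negatives`: 12 entries, none on
amplitude polynomials.

Conventions (as in the crux): occupied = spin up = `Fin`-index `0`; `1_S = fun x => if x ∈ S then 0 else 1`;
the sector of `N` up spins has magnetisation `magOf Λ N = N - |Λ|/2`.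
-/

noncomputable section

namespace Summit.AtomisticToContinuum.BoseEinsteinCondensation.Cruxes.GroundStateStability.HeisenbergPointDeformation

open scoped BigOperators Matrix ComplexOrder Topology
open Filter Literature.MathematicalPhysics.QuantumLattice Literature.Combinatorics.StablePolynomials
open Summit.AtomisticToContinuum.BoseEinsteinCondensation.Theses.BECStronglyRayleigh (GroundStateStability)

/-! ## Objects — geometry of polynomials (coefficient families `a : Finset σ → ℝ`) -/

section Poly

variable {σ : Type} [Fintype σ] [DecidableEq σ]

/-- The **pinned minor** of a coefficient family at `A ⊆ σ`: `q_A(w) = Σ_{T ∩ A = ∅} a(A ∪ T) w^T`, the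
polynomial `∂^A p_a` in the variables off `A` (for a degree-`N` family it has degree `N - |A|`). It is the
localisation of `p_a` at a structural critical zero supported on `A`:
`p_a(y + εv) = ε^{N-|A|} (y^A q_A(v) + O(ε))` when `supp y = A`. -/
def pinnedMinor (a : Finset σ → ℝ) (A : Finset σ) : Finset σ → ℝ :=
  fun T => if Disjoint T A then a (A ∪ T) else 0

/-- **Line-hyperbolicity w.r.t. `𝟙`**: every complex zero `u` of `u ↦ p_a(x + u𝟙)`, `x` real, is real
(Gårding hyperbolicity of the homogeneous `p_a` in the direction `𝟙`, written without degree
hypotheses). Weaker-looking than `H^σ`-stability; equivalent to it for nonnegative homogeneous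
multi-affine families with `p_a(𝟙) > 0` (`GardingOrthant`). -/
def LineHyperbolic (a : Finset σ → ℝ) : Prop :=
  ∀ (x : σ → ℝ) (u : ℂ),
    MvPolynomial.eval (fun i => (x i : ℂ) + u) (multiAffine fun S => (a S : ℂ)) = 0 → u.im = 0

/-- **A bad (= non-structural) real critical zero of some pinned minor**: there are `A ⊆ σ` with
`|A| ≤ N - 2` and a real `y` vanishing on `A` with `|supp y| ≥ N - |A|` at which the pinned minor `q_A`
and all its first partials vanish. (Critical zeros with `|supp y| ≤ N - |A| - 2` exist for EVERY
degree-`(N-|A|)` multi-affine polynomial — each monomial then misses two vanishing coordinates — and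
`|supp y| = N - |A| - 1` is impossible for positive coefficients; only `|supp y| ≥ N - |A|` carries
information.) -/
def HasBadCriticalZero (a : Finset σ → ℝ) (N : ℕ) : Prop :=
  ∃ (A : Finset σ) (y : σ → ℝ), A.card + 2 ≤ N ∧ (∀ i ∈ A, y i = 0) ∧
    N ≤ A.card + (Finset.univ.filter fun i => y i ≠ 0).card ∧
    MvPolynomial.eval y (multiAffine (pinnedMinor a A)) = 0 ∧
    ∀ j, MvPolynomial.eval y (MvPolynomial.pderiv j (multiAffine (pinnedMinor a A))) = 0

end Poly

/-! ## Objects — the hard-core lattice gas (`H = xxzHamiltonian 1 G (-1) Δ + Σ μ_x Sᶻ_x`) -/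

section Phys

variable {Λ : Type} [Fintype Λ] [DecidableEq Λ]

/-- The occupation configuration of `S ⊆ Λ` — literally the crux's `fun x => if x ∈ S then 0 else 1`. -/
def ind (S : Finset Λ) : TensorIndex Λ 2 := fun x => if x ∈ S then 0 else 1

/-- The real amplitude family `S ↦ Re ψ(1_S)` of a vector (its generating polynomial is `p_ψ` when `ψ`
is real). -/
def reAmp (ψ : TensorIndex Λ 2 → ℂ) : Finset Λ → ℝ := fun S => (ψ (ind S)).re

/-- `H^Λ`-stability of the amplitude polynomial `Σ_S ψ(1_S) z^S`, in the crux's inline form. -/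
def AmpStable (ψ : TensorIndex Λ 2 → ℂ) : Prop :=
  ∀ z : Λ → ℂ, (∀ x, 0 < (z x).im) → (∑ S : Finset Λ, ψ (ind S) * ∏ x ∈ S, z x) ≠ 0

/-- The Hamiltonian of the crux at anisotropy `Δ` and fields `μ` (verbatim). -/
def ham (G : SimpleGraph Λ) [DecidableRel G.Adj] (Δ : ℝ) (μ : Λ → ℝ) : Op Λ 2 :=
  xxzHamiltonian 1 G (-1) Δ + ∑ x : Λ, ((μ x : ℝ) : ℂ) • siteSpin 1 x 2

/-- The magnetisation `N - |Λ|/2` of the sector with `N` up spins (= `N` bosons). -/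
def magOf (Λ : Type) [Fintype Λ] (N : ℕ) : ℝ := (N : ℝ) - (Fintype.card Λ : ℝ) / 2

/-- `ψ` is a ground vector of the `N`-particle sector of `H(Δ, μ)` — exactly the crux's hypotheses with
`M = N - |Λ|/2`. -/
def IsGround (G : SimpleGraph Λ) [DecidableRel G.Adj] (Δ : ℝ) (μ : Λ → ℝ) (N : ℕ)
    (ψ : TensorIndex Λ 2 → ℂ) : Prop :=
  ψ ∈ spinZSector (Λ := Λ) 1 (magOf Λ N) ∧ ψ ≠ 0 ∧
    (ham G Δ μ).mulVec ψ = ((lowestEnergyInSector 1 (ham G Δ μ) (magOf Λ N) : ℝ) : ℂ) • ψ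

/-- A **positive** ground vector of the `N`-particle sector: real, and strictly positive on every
`N`-set (the Perron–Frobenius normal form of a sector ground vector on a connected graph). -/
def IsPosGround (G : SimpleGraph Λ) [DecidableRel G.Adj] (Δ : ℝ) (μ : Λ → ℝ) (N : ℕ)
    (ψ : TensorIndex Λ 2 → ℂ) : Prop :=
  IsGround G Δ μ N ψ ∧ (∀ τ, (ψ τ).im = 0) ∧ ∀ S : Finset Λ, S.card = N → 0 < (ψ (ind S)).re

/-- The amplitude polynomial at a complex point: `p_ψ(y) = Σ_S ψ(1_S) y^S` (`= ⟨Φ(y), ψ⟩` for the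
unnormalised product vector `Φ(y) = ⊗_x (|↓⟩ + y_x|↑⟩)`, bilinear pairing). -/
def ampEval (ψ : TensorIndex Λ 2 → ℂ) (y : Λ → ℂ) : ℂ :=
  ∑ S : Finset Λ, ψ (ind S) * ∏ x ∈ S, y x

/-- `∂_a p_ψ(y) = Σ_{S ∋ a} ψ(1_S) y^{S ∖ a}`. -/
def ampD1 (ψ : TensorIndex Λ 2 → ℂ) (a : Λ) (y : Λ → ℂ) : ℂ :=
  ∑ S : Finset Λ, if a ∈ S then ψ (ind S) * ∏ x ∈ S.erase a, y x else 0

/-- `∂_a∂_b p_ψ(y) = Σ_{S ∋ a, b} ψ(1_S) y^{S ∖ {a,b}}` for `a ≠ b` (and `0` on the diagonal). -/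
def ampD2 (ψ : TensorIndex Λ 2 → ℂ) (a b : Λ) (y : Λ → ℂ) : ℂ :=
  ∑ S : Finset Λ, if a ∈ S ∧ b ∈ S ∧ a ≠ b then ψ (ind S) * ∏ x ∈ (S.erase a).erase b, y x else 0

/-- The bond "diffusion coefficient" of `H` in coherent variables, `q_Δ(u, v) = ½(u² + v²) - Δuv`:
a nonnegative real quadratic form iff `|Δ| ≤ 1`, positive definite iff `|Δ| < 1` — the window is
ellipticity. -/
def qΔ (Δ : ℝ) (u v : ℂ) : ℂ := (u ^ 2 + v ^ 2) / 2 - (Δ : ℂ) * u * v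

end Phys

/-! ## The seven statements of the line -/

/-- STATEMENT 1 — **sector Perron–Frobenius for the hard-core (`J = -1`) XXZ model with fields**, on a
connected graph, for ANY real `Δ, μ` (no window): a nonempty magnetisation sector `M` is the `N`-particle
sector for some `N` (`M = N - |Λ|/2`), it contains a POSITIVE real ground vector, and every ground vector
of the sector is a complex multiple of it. Content: in the occupation basis `H` is real symmetric with
off-diagonal entries `-½·[token hop] ≤ 0` (`-(SˣSˣ+SʸSʸ) = -½(S⁺S⁻+S⁻S⁺)`, `ΔSᶻSᶻ` and fields diagonal),
sectors are coordinate blocks (`LiebMattis.mem_spinZSector_iff`), the token graph of a connected graph is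
connected (`TokenSliding.exists_slide_out`), `E_min` bounds the block from below (`sector_groundState`);
abstract PF `perronFrobenius_groundState_pos/unique`. The XXZ analogue of
`LiebMattis.sector_perronFrobenius` (shared in substance with `stub_sectorPerron` /
`stub_sectorGroundUnique` of the two preserver lines). -/
def SectorPerron : Prop :=
  ∀ (Λ : Type) [Fintype Λ] [DecidableEq Λ] (G : SimpleGraph Λ) [DecidableRel G.Adj], G.Connected →
    ∀ (Δ : ℝ) (μ : Λ → ℝ) (M : ℝ) (ψ₀ : TensorIndex Λ 2 → ℂ),
      ψ₀ ∈ spinZSector (Λ := Λ) 1 M → ψ₀ ≠ 0 →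
      ∃ N : ℕ, M = magOf Λ N ∧ ∃ φ : TensorIndex Λ 2 → ℂ, IsPosGround G Δ μ N φ ∧
        ∀ ψ : TensorIndex Λ 2 → ℂ, ψ ∈ spinZSector (Λ := Λ) 1 M →
          (ham G Δ μ).mulVec ψ = ((lowestEnergyInSector 1 (ham G Δ μ) M : ℝ) : ℂ) • ψ →
          ∃ c : ℂ, ψ = c • φ

/-- STATEMENT 2 — **the coherent-variable representation of `H`** (an exact OPERATOR identity, all
vectors `ψ`, all complex points `y`; each edge appears twice in the double sum, hence the `½`):
`p_{Hψ}(y) = Σ_{ab ∈ E} [q_Δ(y_a,y_b) ∂_a∂_b p_ψ - ½(y_b - Δy_a)∂_a p_ψ - ½(y_a - Δy_b)∂_b p_ψ - (Δ/4)p_ψ]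
  + Σ_a μ_a (y_a ∂_a p_ψ - ½ p_ψ)`.
Content: `p_φ(y) = ⟨Φ(y), φ⟩`, `H` is real symmetric, and on product vectors
`⟨S⁺_aS⁻_bΦ, ψ⟩ = y_b(∂_a p - y_b ∂_{ab}p)`, `⟨Sᶻ_aSᶻ_bΦ, ψ⟩ = y_ay_b∂_{ab}p - ½y_a∂_a p - ½y_b∂_b p + ¼p`,
`⟨Sᶻ_aΦ, ψ⟩ = y_a∂_a p - ½p`; pure bookkeeping over the occupation-basis action of the bond
(`Disproof.xxzBond_mulVec_apply`: `Δ s_x s_y φ(σ) + ½[σ_x ≠ σ_y] φ(σ^{xy})`). Verified numerically in the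
tree conventions (planner, `compute/check_coherent_rep.py`; triage r1-2 T1 exact, 0/40). -/
def CoherentRepresentation : Prop :=
  ∀ (Λ : Type) [Fintype Λ] [DecidableEq Λ] (G : SimpleGraph Λ) [DecidableRel G.Adj] (Δ : ℝ)
    (μ : Λ → ℝ) (ψ : TensorIndex Λ 2 → ℂ) (y : Λ → ℂ),
    ampEval ((ham G Δ μ).mulVec ψ) y =
      (1 / 2 : ℂ) * (∑ a : Λ, ∑ b : Λ, if G.Adj a b then
          (qΔ Δ (y a) (y b) * ampD2 ψ a b y
            - (y b - (Δ : ℂ) * y a) / 2 * ampD1 ψ a y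
            - (y a - (Δ : ℂ) * y b) / 2 * ampD1 ψ b y
            - (Δ : ℂ) / 4 * ampEval ψ y) else 0) +
      ∑ a : Λ, ((μ a : ℝ) : ℂ) * (y a * ampD1 ψ a y - (1 / 2 : ℂ) * ampEval ψ y)

/-- STATEMENT 3 — **the anchor: the ferromagnetic `SU(2)` point `(Δ, μ) = (1, 0)`**. A positive
`N`-particle ground vector of `-Σ_{ab∈E} 𝐒_a·𝐒_b` on a connected graph is constant on `N`-sets
(`¼ - 𝐒_a·𝐒_b ≥ 0` is the bond-singlet projector, so a ground vector — energy `-|E|/4` — is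
swap-invariant along every edge, and token sliding along edges connects all `N`-sets), i.e.
`p = c·e_N`, `c > 0`. Consequently (i) `p` is line-hyperbolic (indeed real stable,
`isRealStable_esymm`; `IsRealStable.im_eq_zero_of_eval₂_line_eq_zero`), and (ii) no pinned minor
`c·e_{N-|A|}(w_{Λ∖A})` has a critical zero `y` with `|supp y| ≥ N - |A|`: from `e_{k-1}(y_{T∖i}) = 0`
for all `i ∈ T = supp y`, `|T| ≥ k`, the identities `Σ_{i∈T} e_j(y_{T∖i}) = (|T|-j) e_j(y_T)` and
`e_j(y_T) = e_j(y_{T∖i}) + y_i e_{j-1}(y_{T∖i})` descend to `e_0 = 0`, absurd. -/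
def HeisenbergAnchor : Prop :=
  ∀ (Λ : Type) [Fintype Λ] [DecidableEq Λ] (G : SimpleGraph Λ) [DecidableRel G.Adj], G.Connected →
    ∀ (N : ℕ) (φ : TensorIndex Λ 2 → ℂ), IsPosGround G 1 (fun _ => 0) N φ →
      LineHyperbolic (reAmp φ) ∧ ¬ HasBadCriticalZero (reAmp φ) N

/-- STATEMENT 4 — **first loss along a segment** (soft analysis; from sector PF). On a connected graph fix
`N` and a straight segment `t ↦ (Δ₀ + t(Δ₁ - Δ₀), μ₀ + t(μ₁ - μ₀))`, `t ∈ [0,1]`, in parameter space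
(no window needed). If every positive `N`-particle ground vector at `t = 0` is line-hyperbolic and some
positive ground vector at `t = 1` is not, then there is a FIRST-LOSS time `t* ∈ [0, 1)`: a positive
ground vector `φ` at `t*` that IS line-hyperbolic, and positive ground vectors `φₙ` at times `tₙ → t*`
(`tₙ ∈ [0,1]`) that are NOT, with `φₙ → φ`. Content: the unit positive ground vector is unique (PF) and
continuous in `t` (compactness + uniqueness of the minimiser of the sector Rayleigh quotient, `E_min`
continuous); line-hyperbolicity of positive degree-`N` families is closed under limits (one-variable
Hurwitz: `eq_zero_or_isUpperHalfPlaneStable_of_tendsto_coeff` with `σ = Unit` on `u ↦ p(x + u𝟙)`, whose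
leading coefficient `p(𝟙) > 0` survives); `t* = inf {t : not hyperbolic}` then lies in the closed good
set, is `< 1`, and is approached from the bad set. -/
def FirstLossPrinciple : Prop :=
  ∀ (Λ : Type) [Fintype Λ] [DecidableEq Λ] (G : SimpleGraph Λ) [DecidableRel G.Adj], G.Connected →
    ∀ (N : ℕ) (Δ₀ Δ₁ : ℝ) (μ₀ μ₁ : Λ → ℝ),
      (∀ φ : TensorIndex Λ 2 → ℂ, IsPosGround G Δ₀ μ₀ N φ → LineHyperbolic (reAmp φ)) →
      (∃ φ : TensorIndex Λ 2 → ℂ, IsPosGround G Δ₁ μ₁ N φ ∧ ¬ LineHyperbolic (reAmp φ)) →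
      ∃ t : ℝ, 0 ≤ t ∧ t < 1 ∧ ∃ φ : TensorIndex Λ 2 → ℂ,
        IsPosGround G (Δ₀ + t * (Δ₁ - Δ₀)) (μ₀ + t • (μ₁ - μ₀)) N φ ∧ LineHyperbolic (reAmp φ) ∧
        ∃ (ts : ℕ → ℝ) (φs : ℕ → TensorIndex Λ 2 → ℂ),
          (∀ n, 0 ≤ ts n ∧ ts n ≤ 1 ∧
            IsPosGround G (Δ₀ + ts n * (Δ₁ - Δ₀)) (μ₀ + ts n • (μ₁ - μ₀)) N (φs n) ∧
            ¬ LineHyperbolic (reAmp (φs n))) ∧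
          Tendsto ts atTop (𝓝 t) ∧ Tendsto φs atTop (𝓝 φ)

/-- STATEMENT 5 — **the sharpened loss lemma** (pure geometry of polynomials; the triage's precondition
for an all-`N` line, typed). If real coefficient families `bₙ → a` on a finite set `σ`, all supported on
`N`-sets, with `a > 0` on every `N`-set, are such that `p_a` is line-hyperbolic but no `p_{bₙ}` is, then
`a` has a bad critical zero: some pinned minor `q_A`, `|A| ≤ N - 2`, has a real critical zero of support
`≥ N - |A|` off `A`. (`N ≤ 1` and `|σ| < N` make the hypotheses contradictory, so no guard is needed.)
Proof sketch in the module docstring / line card: conjugate-pair merging (one-variable Hurwitz +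
continuity of division by a monic quadratic), the Atiyah–Bott–Gårding order-two lemma (the
localisation of a hyperbolic polynomial at a real zero is hyperbolic in the same direction, so the
multiplicity of `0` as a root of `s ↦ q(y + s𝟙)` is the order of vanishing of `q` at `y`: Pemantle,
arXiv:1210.3231, Prop. 3.1 = ABG (3.45); elementary by rescaling), and the blow-up recursion on the structural
stratum using the exact multi-affine expansion `p(y + εv) = Σ_{B ⊆ supp y} y^B ε^{N-|B|} (∂^B p)(v)`. -/
def SharpenedLossLemma : Prop :=
  ∀ (σ : Type) [Fintype σ] [DecidableEq σ] (N : ℕ) (a : Finset σ → ℝ) (b : ℕ → Finset σ → ℝ),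
    (∀ S, S.card = N → 0 < a S) → (∀ S, S.card ≠ N → a S = 0) → (∀ n S, S.card ≠ N → b n S = 0) →
    Tendsto b atTop (𝓝 a) → LineHyperbolic a → (∀ n, ¬ LineHyperbolic (b n)) →
    HasBadCriticalZero a N

/-- STATEMENT 6 — **no bad critical zero in the open window** (the card's transfer `C⁺`; THE HARDEST, the
only consumer of `|Δ| < 1`). For connected `G`, `|Δ| < 1`, any real fields and any `N`, no pinned minor
of a positive `N`-particle ground vector has a non-structural real critical zero. Content, `N = 2`
(complete): a bad critical zero is a nonzero kernel vector `y` of the pair matrix; the coherent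
representation at an eigenvector and a critical zero of `p` collapses to
`Σ_{ab∈E} q_Δ(y_a,y_b) ψ_{ab} = 0` with `ψ_{ab} > 0`, `q_Δ ≻ 0`, so `y_a = y_b = 0` edge by edge and
`y = 0` on a connected graph. `N ≥ 3` (open heart): a bad critical zero of `q_A` satisfies the coupled
identities (★_A) `Σ_{ab∈E(Λ∖A)} q_Δ(y_a,y_b)∂_a∂_b q_A(y) = ½Σ_{i∈A}Σ_{c∼i,c∉A} m_{i→c}(y)` obtained by
differentiating STATEMENT 2 in `y_A`; the claim is that their sign structure (Perron positivity, `q_Δ ≻ 0`,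
ground = minimal energy) excludes a solution with `|supp y| ≥ N - |A|`. Sharp: FALSE at `Δ = -1`, `μ = 0`
on bipartite graphs (the Néel sign vector is a full-support critical zero of `p`, Lieb–Mattis lowest
weight) — consistent with `Disproof.groundStateStability_false_with_window` and the refuters' `Δ < -1`
data; numerics inside the window: card T5b, kit j007464 (no bad critical zero of `p` found, N = 3, 4). -/
def NoBadCriticalZero : Prop :=
  ∀ (Λ : Type) [Fintype Λ] [DecidableEq Λ] (G : SimpleGraph Λ) [DecidableRel G.Adj], G.Connected →
    ∀ (Δ : ℝ) (μ : Λ → ℝ), |Δ| < 1 → ∀ (N : ℕ) (φ : TensorIndex Λ 2 → ℂ), IsPosGround G Δ μ N φ →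
      ¬ HasBadCriticalZero (reAmp φ) N

/-- STATEMENT 7 — **Gårding's cone theorem on the orthant** (classical: Gårding, Acta Math. 85 (1951);
Pemantle arXiv:1210.3231 Prop. 2.6, proof after Güler): a homogeneous multi-affine polynomial with NONNEGATIVE coefficients, not
identically zero, that is hyperbolic with respect to `𝟙` is `H^σ`-stable — the open positive orthant is
connected, contains `𝟙` and misses the real zero set (`p > 0` there), so it lies in the hyperbolicity cone
of `𝟙`, and a zero `x + ie`, `e > 0`, would be the non-real root `u = i` of `u ↦ p(x + ue)`. Stated with
the crux's inline form of stability as conclusion. -/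
def GardingOrthant : Prop :=
  ∀ (σ : Type) [Fintype σ] [DecidableEq σ] (N : ℕ) (a : Finset σ → ℝ),
    (∀ S, 0 ≤ a S) → (∀ S, S.card ≠ N → a S = 0) → (∃ S, 0 < a S) → LineHyperbolic a →
    ∀ z : σ → ℂ, (∀ i, 0 < (z i).im) → (∑ S : Finset σ, (a S : ℂ) * ∏ i ∈ S, z i) ≠ 0

/-! ## Registered stubs -/

/-- STUB 1 (M). Sector Perron–Frobenius for `xxzHamiltonian 1 G (-1) Δ + Σ μ_x Sᶻ_x` on a connected
graph. See `SectorPerron`. -/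
theorem stub_sectorPerron : SectorPerron := by
  sorry

/-- STUB 2 (M). The coherent-variable representation of `H` (finite bookkeeping identity). See
`CoherentRepresentation`. -/
theorem stub_coherentRep : CoherentRepresentation := by
  sorry

/-- STUB 3 (M). The `SU(2)` anchor: positive ground vectors at `(1, 0)` are `c·e_N`; line-hyperbolic and
critically rigid. See `HeisenbergAnchor`. -/
theorem stub_anchor : HeisenbergAnchor := by
  sorry

/-- STUB 4 (M–L). First loss of line-hyperbolicity along a parameter segment, from sector PF. See
`FirstLossPrinciple`. -/
theorem stub_firstLoss : SectorPerron → FirstLossPrinciple := by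
  sorry

/-- STUB 5 (L). The sharpened loss lemma: loss of line-hyperbolicity in a positive multi-affine limit
exhibits a non-structural real critical zero of a pinned minor. See `SharpenedLossLemma`. -/
theorem stub_sharpenedLoss : SharpenedLossLemma := by
  sorry

/-- STUB 6 (XL; HARDEST, LOAD-BEARING — the only consumer of `|Δ| < 1`). No bad critical zero of any
pinned minor of a positive sector ground vector inside the open window, from the coherent
representation. See `NoBadCriticalZero`. -/
theorem stub_noCriticalZero : CoherentRepresentation → NoBadCriticalZero := by
  sorry

/-- STUB 7 (M). Gårding's cone theorem restricted to the orthant, for nonnegative homogeneous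
multi-affine polynomials. See `GardingOrthant`. -/
theorem stub_gardingOrthant : GardingOrthant := by
  sorry

/-! ## Name-keyed aliases of the seven statements (hypotheses of the composition)

`Registered.stub_X` is the statement of `stub_X` under the registered stub's short name, so that the
native skeleton audit (hypotheses admissible iff registered stubs BY NAME) accepts
`GroundStateStability_of : Registered.stub_sectorPerron → … → GroundStateStability`
(device of `Lines/six-vertex-euler-gates.lean`). -/
namespace Registered

/-- Alias of `SectorPerron` keyed by the registered stub name. -/
abbrev stub_sectorPerron : Prop := SectorPerron
/-- Alias of `CoherentRepresentation` keyed by the registered stub name. -/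
abbrev stub_coherentRep : Prop := CoherentRepresentation
/-- Alias of `HeisenbergAnchor` keyed by the registered stub name. -/
abbrev stub_anchor : Prop := HeisenbergAnchor
/-- Alias of the statement of `stub_firstLoss`. -/
abbrev stub_firstLoss : Prop := SectorPerron → FirstLossPrinciple
/-- Alias of `SharpenedLossLemma` keyed by the registered stub name. -/
abbrev stub_sharpenedLoss : Prop := SharpenedLossLemma
/-- Alias of the statement of `stub_noCriticalZero`. -/
abbrev stub_noCriticalZero : Prop := CoherentRepresentation → NoBadCriticalZero
/-- Alias of `GardingOrthant` keyed by the registered stub name. -/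
abbrev stub_gardingOrthant : Prop := GardingOrthant

end Registered

/-! ## Proved glue -/

section Glue

variable {Λ : Type} [Fintype Λ] [DecidableEq Λ]

/-- Every configuration is the occupation configuration of its set of up-spins. -/
theorem ind_filter_eq (τ : TensorIndex Λ 2) :
    ind (Finset.univ.filter fun x => τ x = 0) = τ := by
  funext x
  simp only [ind, Finset.mem_filter, Finset.mem_univ, true_and]
  split_ifs with h
  · exact h.symm
  · apply Fin.ext
    have h1 : (τ x).val ≠ 0 := fun h0 => h (Fin.ext h0)
    have h2 := (τ x).isLt
    rw [Fin.val_one]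
    omega

/-- The weight sum of an occupation configuration: `Σ_x (½ - (1_S)_x) = |S| - |Λ|/2`. -/
theorem weightSum_ind (S : Finset Λ) :
    (∑ x : Λ, (((1 : ℕ) : ℂ) / 2 - (((ind S x : Fin 2) : ℕ) : ℂ))) =
      (S.card : ℂ) - (Fintype.card Λ : ℂ) / 2 := by
  have h : ∀ x : Λ, (((1 : ℕ) : ℂ) / 2 - (((ind S x : Fin 2) : ℕ) : ℂ)) =
      (if x ∈ S then (1 : ℂ) else 0) - 1 / 2 := by
    intro x
    unfold ind
    split_ifs <;> push_cast <;> norm_num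
  rw [Finset.sum_congr rfl fun x _ => h x, Finset.sum_sub_distrib, Finset.sum_const,
    Finset.card_univ, Finset.sum_boole]
  have hf : (Finset.univ.filter fun x => x ∈ S) = S := by
    ext x; simp
  rw [hf, nsmul_eq_mul]
  ring

/-- A vector of the `N`-particle sector has amplitude `0` on every set of cardinality `≠ N`. -/
theorem amp_eq_zero_of_card_ne {N : ℕ} {φ : TensorIndex Λ 2 → ℂ}
    (hφ : φ ∈ spinZSector (Λ := Λ) 1 (magOf Λ N)) {S : Finset Λ} (hS : S.card ≠ N) :
    φ (ind S) = 0 := by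
  by_contra h
  have h1 := (LiebMattis.mem_spinZSector_iff (Λ := Λ) 1 (magOf Λ N) φ).1 hφ (ind S) h
  rw [weightSum_ind] at h1
  apply hS
  have h2 : (S.card : ℂ) = (N : ℂ) := by
    have : ((magOf Λ N : ℝ) : ℂ) = (N : ℂ) - (Fintype.card Λ : ℂ) / 2 := by
      simp [magOf]
    rw [this] at h1
    linear_combination h1
  exact_mod_cast h2

omit [Fintype Λ] in
/-- The real amplitude family of a real vector, cast back to `ℂ`, is its amplitude family. -/
theorem reAmp_cast {φ : TensorIndex Λ 2 → ℂ} (hφ : ∀ τ, (φ τ).im = 0) (S : Finset Λ) :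
    ((reAmp φ S : ℝ) : ℂ) = φ (ind S) :=
  Complex.ext (by simp [reAmp]) (by simp [reAmp, hφ])

omit [Fintype Λ] in
/-- `ψ ↦ reAmp ψ` is continuous (coordinate projections and `re`). -/
theorem continuous_reAmp :
    Continuous (fun ψ : TensorIndex Λ 2 → ℂ => reAmp ψ) :=
  continuous_pi fun S => Complex.continuous_re.comp (continuous_apply (ind S))

omit [Fintype Λ] in
/-- Limits of vectors give limits of real amplitude families. -/
theorem tendsto_reAmp {φs : ℕ → TensorIndex Λ 2 → ℂ} {φ : TensorIndex Λ 2 → ℂ}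
    (h : Tendsto φs atTop (𝓝 φ)) : Tendsto (fun n => reAmp (φs n)) atTop (𝓝 (reAmp φ)) :=
  (continuous_reAmp.tendsto φ).comp h

/-- **Gårding at work**: a positive ground vector with line-hyperbolic amplitude polynomial is
amplitude-stable (STATEMENT 7 applied to its real amplitude family). -/
theorem ampStable_of_lineHyperbolic (h7 : GardingOrthant) {G : SimpleGraph Λ} [DecidableRel G.Adj]
    {Δ : ℝ} {μ : Λ → ℝ} {N : ℕ} {φ : TensorIndex Λ 2 → ℂ} (hφ : IsPosGround G Δ μ N φ)
    (hhyp : LineHyperbolic (reAmp φ)) : AmpStable φ := by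
  obtain ⟨⟨hsec, hne, -⟩, hreal, hpos⟩ := hφ
  -- nonnegativity and support of the real amplitude family
  have hnn : ∀ S, 0 ≤ reAmp φ S := by
    intro S
    by_cases hS : S.card = N
    · exact (hpos S hS).le
    · simp [reAmp, amp_eq_zero_of_card_ne hsec hS]
  have hsupp : ∀ S : Finset Λ, S.card ≠ N → reAmp φ S = 0 := fun S hS => by
    simp [reAmp, amp_eq_zero_of_card_ne hsec hS]
  -- a positive coefficient exists: φ ≠ 0 is supported on N-sets
  have hex : ∃ S, 0 < reAmp φ S := by
    by_contra hnone
    push Not at hnone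
    apply hne
    funext τ
    have hτ : φ (ind (Finset.univ.filter fun x => τ x = 0)) = 0 := by
      set S := Finset.univ.filter fun x => τ x = 0
      by_cases hS : S.card = N
      · exact absurd (hpos S hS) (not_lt.2 (hnone S))
      · exact amp_eq_zero_of_card_ne hsec hS
    rw [ind_filter_eq] at hτ
    exact hτ
  intro z hz
  have h := h7 Λ N (reAmp φ) hnn hsupp hex hhyp z hz
  have hsum : (∑ S : Finset Λ, ((reAmp φ S : ℝ) : ℂ) * ∏ i ∈ S, z i) =
      ∑ S : Finset Λ, φ (ind S) * ∏ x ∈ S, z x :=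
    Finset.sum_congr rfl fun S _ => by rw [reAmp_cast hreal S]
  rwa [hsum] at h

/-- **The segment lemma** (first loss + sharpened loss + no bad critical zero): if at the start of a
parameter segment every positive ground vector is line-hyperbolic and critically rigid, and at every
interior point every positive ground vector is critically rigid, then every positive ground vector at the
end of the segment is line-hyperbolic. -/
theorem lineHyperbolic_propagate (h4 : FirstLossPrinciple) (h5 : SharpenedLossLemma)
    (G : SimpleGraph Λ) [DecidableRel G.Adj] (hG : G.Connected) (N : ℕ) (Δ₀ Δ₁ : ℝ) (μ₀ μ₁ : Λ → ℝ)
    (h0hyp : ∀ φ : TensorIndex Λ 2 → ℂ, IsPosGround G Δ₀ μ₀ N φ → LineHyperbolic (reAmp φ))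
    (h0crit : ∀ φ : TensorIndex Λ 2 → ℂ, IsPosGround G Δ₀ μ₀ N φ → ¬ HasBadCriticalZero (reAmp φ) N)
    (hmid : ∀ t : ℝ, 0 < t → t < 1 → ∀ φ : TensorIndex Λ 2 → ℂ,
      IsPosGround G (Δ₀ + t * (Δ₁ - Δ₀)) (μ₀ + t • (μ₁ - μ₀)) N φ → ¬ HasBadCriticalZero (reAmp φ) N) :
    ∀ φ : TensorIndex Λ 2 → ℂ, IsPosGround G Δ₁ μ₁ N φ → LineHyperbolic (reAmp φ) := by
  intro φ hφ
  by_contra hnot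
  obtain ⟨t, ht0, ht1, φl, hφl, hhyp, ts, φs, hseq, -, hlim⟩ :=
    h4 Λ G hG N Δ₀ Δ₁ μ₀ μ₁ h0hyp ⟨φ, hφ, hnot⟩
  -- the sharpened loss lemma on the real amplitude families
  have hbad : HasBadCriticalZero (reAmp φl) N := by
    refine h5 Λ N (reAmp φl) (fun n => reAmp (φs n)) (fun S hS => hφl.2.2 S hS) ?_ ?_
      (tendsto_reAmp hlim) hhyp (fun n => (hseq n).2.2.2)
    · intro S hS
      simp [reAmp, amp_eq_zero_of_card_ne hφl.1.1 hS]
    · intro n S hS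
      simp [reAmp, amp_eq_zero_of_card_ne (hseq n).2.2.1.1.1 hS]
  rcases ht0.eq_or_lt with h0 | hpos
  · -- first loss at the start of the segment: contradicts critical rigidity there
    subst h0
    have hφl0 : IsPosGround G Δ₀ μ₀ N φl := by simpa using hφl
    exact h0crit φl hφl0 hbad
  · exact hmid t hpos ht1 φl hφl hbad

end Glue

/-! ## The composition: the seven stubs imply the crux, by name -/

/-- **`GroundStateStability` from the seven stubs** (no `sorry`). Given the crux's data — connected `G`,
`|Δ| ≤ 1`, fields `μ`, a sector ground vector `ψ ≠ 0` of magnetisation `M` — STUB 1 identifies the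
sector as the `N`-particle sector, provides a positive ground vector `φ` and `ψ = c φ`; the segment lemma
along `(1,0) → (0,0)` (STUB 3 at `t = 0`, STUB 6 inside, STUBS 4–5 as the engine) makes every positive
ground vector at the XY point line-hyperbolic, and along `(0,0) → (Δ,μ)` (STUB 6 at `t = 0` and inside)
the same at the target; STUB 7 upgrades line-hyperbolicity of `p_φ` to `H^Λ`-stability; `c ≠ 0`. -/
theorem GroundStateStability_of (h1 : Registered.stub_sectorPerron)
    (h2 : Registered.stub_coherentRep) (h3 : Registered.stub_anchor)
    (h4 : Registered.stub_firstLoss) (h5 : Registered.stub_sharpenedLoss)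
    (h6 : Registered.stub_noCriticalZero) (h7 : Registered.stub_gardingOrthant) :
    GroundStateStability := by
  have hFL : FirstLossPrinciple := h4 h1
  have hNC : NoBadCriticalZero := h6 h2
  intro Λ _ _ G _ hG Δ μ hΔ M ψ hψ hψ0 hHψ z hz
  -- sector Perron–Frobenius at the target parameters
  obtain ⟨N, hM, φ, hφ, huniq⟩ := h1 Λ G hG Δ μ M ψ hψ hψ0
  subst hM
  -- segment 1: from the SU(2) anchor (1, 0) to the XY point (0, 0)
  have hXY : ∀ φ' : TensorIndex Λ 2 → ℂ, IsPosGround G 0 (fun _ => 0) N φ' →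
      LineHyperbolic (reAmp φ') := by
    refine lineHyperbolic_propagate hFL h5 G hG N 1 0 (fun _ => 0) (fun _ => 0)
      (fun φ' h => (h3 Λ G hG N φ' h).1) (fun φ' h => (h3 Λ G hG N φ' h).2) ?_
    intro t ht0 ht1 φ' hφ'
    refine hNC Λ G hG _ _ ?_ N φ' hφ'
    rw [abs_lt]
    constructor <;> nlinarith
  -- segment 2: from (0, 0) to (Δ, μ)
  have hT : ∀ φ' : TensorIndex Λ 2 → ℂ, IsPosGround G Δ μ N φ' → LineHyperbolic (reAmp φ') := by
    refine lineHyperbolic_propagate hFL h5 G hG N 0 Δ (fun _ => 0) μ hXY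
      (fun φ' h => hNC Λ G hG 0 _ (by simp) N φ' h) ?_
    intro t ht0 ht1 φ' hφ'
    refine hNC Λ G hG _ _ ?_ N φ' hφ'
    have habs : |0 + t * (Δ - 0)| = t * |Δ| := by
      rw [zero_add, sub_zero, abs_mul, abs_of_pos ht0]
    rw [habs]
    nlinarith [abs_nonneg Δ]
  -- Gårding: the positive ground vector φ is amplitude-stable; ψ = c • φ with c ≠ 0
  have hstab : AmpStable φ := ampStable_of_lineHyperbolic h7 hφ (hT φ hφ)
  obtain ⟨c, hc⟩ := huniq ψ hψ hHψ
  have hc0 : c ≠ 0 := by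
    rintro rfl
    exact hψ0 (by rw [hc, zero_smul])
  subst hc
  have hsum : (∑ S : Finset Λ, (c • φ) (fun x => if x ∈ S then 0 else 1) * ∏ x ∈ S, z x) =
      c * ∑ S : Finset Λ, φ (ind S) * ∏ x ∈ S, z x := by
    rw [Finset.mul_sum]
    refine Finset.sum_congr rfl fun S _ => ?_
    simp only [Pi.smul_apply, smul_eq_mul, mul_assoc]
    rfl
  rw [hsum]
  exact mul_ne_zero hc0 (hstab z hz)

/-- Wiring check: the registered stubs feed `GroundStateStability_of` as stated. -/
example : GroundStateStability :=
  GroundStateStability_of stub_sectorPerron stub_coherentRep stub_anchor stub_firstLoss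
    stub_sharpenedLoss stub_noCriticalZero stub_gardingOrthant

end Summit.AtomisticToContinuum.BoseEinsteinCondensation.Cruxes.GroundStateStability.HeisenbergPointDeformation

end
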